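import Mathlib
import HarnessLib

/-!
# `⟨e^{−ΔH}⟩ = 1` certifies volume preservation, not exactness

HONEST FRAMING: exact (Metropolis-corrected) sampling algorithms for lattice gauge theory;
figures of merit are autocorrelation/cost numbers at stated couplings and volumes; no
continuum-physics claim.

Venture `LatticeQCDFlow` (cell pub-lqcd), sub-topic `Scoring`; FANOUT row 11 (`eng-scorerA`,
fitness scorer A).  NEW WORK of the cell (what one validity test of the frozen scorer can and
cannot see), not a published result; nothing is cited as a fact.

## Content

For (flow-)HMC rows the frozen scorer A 0.1.2 (identity `366a0413…`) has exactly one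
engine-independent exact-value test: the series `expmdH = e^{−ΔH}` built from the chain's `dH`
column (score.py l.327) is tested against the reference value `1` ('identity ⟨exp(−dH)⟩ = 1',
oracle_table.py l.350) and a significant deviation raises HARD `V1:exact-mismatch:expmdH`
(score.py l.601).  Row 14's engine-made control half (READ-fthmc-controls-A012.md) showed both
sides of this test with bytes: the planted X-6 (momentum friction — not volume-preserving) is
INVALID at `z = 14.8`, while the planted X-6b (an asymmetric, volume-preserving but NON-reversible
leapfrog) scores VALID at `z = 0.44` although it is not an exact sampler — the documented blind
spot behind docket item L2-A7 (`V10:irreversible`, to be read from the header's reversibility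
block, not from any observable).

This file types WHY the blind spot is structural:

* `sum_weight_mul_expNegDeltaH` / `lintegral_expNegH_mul_expNegDeltaH` — **Creutz's identity
  uses only volume preservation.**  For positive weights `π ∝ e^{−H}` and ANY bijection `σ` of a
  finite state space (resp. any measure-preserving map `Φ` of `(Ω, vol)`),
  `Σ_x π(x) e^{−ΔH(x)} = Σ_x π(σ x) = Σ_x π(x)` with `e^{−ΔH(x)} = π(σ x)/π(x)` (resp.
  `∫ e^{−H} e^{−(H∘Φ − H)} dvol = ∫ e^{−H} dvol`).  No involution / reversibility hypothesis
  enters, so the test cannot distinguish a reversible integrator from an irreversible one.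
* `Witness.*` — **a volume-preserving proposal that passes the identity and is NOT exact.**  Three
  states, target `π = (1, 2, 3)/6`, 'integrator' `σ` = the cyclic shift `0 ↦ 1 ↦ 2 ↦ 0` (a
  bijection, not an involution), Metropolis acceptance `min(1, π(σ x)/π(x))` of the deterministic
  proposal `x ↦ σ x`: the identity holds exactly (`Witness.creutz`: `Σ π e^{−ΔH} = 1`), the kernel
  is a genuine stochastic matrix (`Witness.kernel_row_sum`), yet `π` is NOT invariant
  (`Witness.not_invariant`: the mass arriving at state `1` is `1/6 ≠ π(1) = 2/6`).  With an
  INVOLUTIVE `σ` the same acceptance rule is always exact (Metropolis–Hastings with a deterministic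
  involutive proposal; tree: `Exactness/InvolutiveMetropolis`, `Exactness/InvolutiveJacobian`) —
  the missing ingredient is reversibility of the proposal, which is what L2-A7 asks the header to
  certify.
-/

namespace Summit.Ventures.LatticeQCDFlow.Scoring

open Finset MeasureTheory

/-! ### Creutz's identity from volume preservation alone -/

/-- **Finite form.**  For nonvanishing weights `π` and ANY permutation `σ` of the states,
`Σ_x π(x) · (π(σ x)/π(x)) = Σ_x π(x)`: with `π ∝ e^{−H}` the middle factor is `e^{−ΔH(x)}`,
`ΔH = H(σ x) − H(x)`, so `⟨e^{−ΔH}⟩_π = 1` for every bijective update, involutive or not. -/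
theorem sum_weight_mul_ratio {X : Type*} [Fintype X] (π : X → ℝ) (hπ : ∀ x, π x ≠ 0)
    (σ : Equiv.Perm X) : ∑ x, π x * (π (σ x) / π x) = ∑ x, π x := by
  have h : ∀ x, π x * (π (σ x) / π x) = π (σ x) := fun x => by
    field_simp [hπ x]
  simp_rw [h]
  exact Equiv.sum_comp σ π

/-- The same with an explicit energy: `π(x) = e^{−H(x)}` and `e^{−ΔH(x)} = e^{−(H(σ x) − H(x))}`;
`Σ_x e^{−H(x)} e^{−ΔH(x)} = Σ_x e^{−H(x)}` (so the `π`-average of `e^{−ΔH}` is `1`). -/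
theorem sum_weight_mul_expNegDeltaH {X : Type*} [Fintype X] (H : X → ℝ) (σ : Equiv.Perm X) :
    ∑ x, Real.exp (-H x) * Real.exp (-(H (σ x) - H x)) = ∑ x, Real.exp (-H x) := by
  have h : ∀ x, Real.exp (-H x) * Real.exp (-(H (σ x) - H x)) = Real.exp (-H (σ x)) := fun x => by
    rw [← Real.exp_add]
    congr 1
    ring
  simp_rw [h]
  exact Equiv.sum_comp σ (fun x => Real.exp (-H x))

/-- **Normalised finite form**: `⟨e^{−ΔH}⟩_π = 1` for `π(x) = e^{−H(x)}/Z`. -/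
theorem expect_expNegDeltaH_eq_one {X : Type*} [Fintype X] [Nonempty X] (H : X → ℝ)
    (σ : Equiv.Perm X) :
    (∑ x, Real.exp (-H x) * Real.exp (-(H (σ x) - H x))) / (∑ x, Real.exp (-H x)) = 1 := by
  rw [sum_weight_mul_expNegDeltaH H σ]
  exact div_self (ne_of_gt (sum_pos (fun x _ => Real.exp_pos _) univ_nonempty))

/-- **Measure form.**  For a measure-preserving map `Φ` of `(Ω, vol)` (Liouville: a symplectic,
volume-preserving integrator step, composed or not with a momentum flip) and a measurable energy
`H`: `∫ e^{−H} · e^{−(H∘Φ − H)} dvol = ∫ e^{−H} dvol`.  Only `MeasurePreserving Φ vol vol` is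
used — no involution, no reversibility. -/
theorem lintegral_expNegH_mul_expNegDeltaH {Ω : Type*} [MeasurableSpace Ω] {vol : Measure Ω}
    {Φ : Ω → Ω} (hΦ : MeasurePreserving Φ vol vol) {H : Ω → ℝ} (hH : Measurable H) :
    ∫⁻ x, ENNReal.ofReal (Real.exp (-H x)) * ENNReal.ofReal (Real.exp (-(H (Φ x) - H x))) ∂vol
      = ∫⁻ x, ENNReal.ofReal (Real.exp (-H x)) ∂vol := by
  have hpt : ∀ x, ENNReal.ofReal (Real.exp (-H x)) * ENNReal.ofReal (Real.exp (-(H (Φ x) - H x)))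
      = ENNReal.ofReal (Real.exp (-H (Φ x))) := fun x => by
    rw [← ENNReal.ofReal_mul (Real.exp_pos _).le, ← Real.exp_add]
    congr 2
    ring
  simp_rw [hpt]
  have hf : Measurable fun y => ENNReal.ofReal (Real.exp (-H y)) :=
    ENNReal.measurable_ofReal.comp (Real.measurable_exp.comp hH.neg)
  exact hΦ.lintegral_comp hf

/-! ### The witness: volume-preserving, passes the identity, not exact -/

namespace Witness

/-- Target weights `π = (1/6, 2/6, 3/6)` on three states. -/
noncomputable def pi3 : Fin 3 → ℝ := ![1 / 6, 2 / 6, 3 / 6]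

/-- The 'integrator': the cyclic shift `0 ↦ 1 ↦ 2 ↦ 0` — a bijection (volume-preserving for the
counting measure) that is NOT an involution. -/
def rot : Fin 3 → Fin 3 := ![1, 2, 0]

/-- `rot` is a bijection (volume preservation on a finite set). -/
theorem rot_bijective : Function.Bijective rot := by decide

/-- `rot` is not an involution (`rot (rot 0) = 2 ≠ 0`). -/
theorem rot_not_involutive : ¬ Function.Involutive rot := by
  intro h
  have h0 : rot (rot 0) = 0 := h 0
  revert h0
  decide

/-- The weights are positive … -/
theorem pi3_pos : ∀ x, 0 < pi3 x := by
  intro x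
  fin_cases x <;> simp [pi3]

/-- … and normalised. -/
theorem pi3_sum : ∑ x, pi3 x = 1 := by
  simp [Fin.sum_univ_three, pi3]
  norm_num

/-- **Creutz's identity holds for the witness**: `Σ_x π(x) e^{−ΔH(x)} = Σ_x π(rot x) = 1`. -/
theorem creutz : ∑ x, pi3 x * (pi3 (rot x) / pi3 x) = 1 := by
  simp [Fin.sum_univ_three, pi3, rot]
  norm_num

/-- The Metropolis acceptance probabilities `min(1, π(rot x)/π(x)) = min(1, e^{−ΔH(x)})`:
`0 → 1` and `1 → 2` always accepted (uphill in `π`), `2 → 0` accepted with probability `1/3`. -/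
noncomputable def acc : Fin 3 → ℝ := ![1, 1, 1 / 3]

/-- `acc` IS the Metropolis rule for this target and proposal. -/
theorem acc_spec (x : Fin 3) : acc x = min 1 (pi3 (rot x) / pi3 x) := by
  fin_cases x
  · show (1 : ℝ) = min 1 (2 / 6 / (1 / 6))
    rw [min_eq_left (by norm_num)]
  · show (1 : ℝ) = min 1 (3 / 6 / (2 / 6))
    rw [min_eq_left (by norm_num)]
  · show (1 : ℝ) / 3 = min 1 (1 / 6 / (3 / 6))
    rw [min_eq_right (by norm_num)]
    norm_num

/-- Metropolis kernel with the DETERMINISTIC proposal `x ↦ rot x`: move with probability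
`acc x = min(1, e^{−ΔH})`, else stay. -/
noncomputable def kernel (x y : Fin 3) : ℝ :=
  if y = rot x then acc x else if y = x then 1 - acc x else 0

/-- Off the diagonal the kernel is the Metropolis rule `min(1, π(rot x)/π(x))·[y = rot x]`. -/
theorem kernel_offdiag {x y : Fin 3} (hxy : y ≠ x) :
    kernel x y = if y = rot x then min 1 (pi3 (rot x) / pi3 x) else 0 := by
  simp only [kernel, hxy, if_false, acc_spec]

/-- The kernel entries are nonnegative … -/
theorem kernel_nonneg (x y : Fin 3) : 0 ≤ kernel x y := by
  fin_cases x <;> fin_cases y <;> simp [kernel, acc, rot]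
  norm_num

/-- … and every row sums to one: a genuine Markov kernel. -/
theorem kernel_row_sum (x : Fin 3) : ∑ y, kernel x y = 1 := by
  fin_cases x <;> simp [Fin.sum_univ_three, kernel, acc, rot]

/-- The mass arriving at state `1` after one step from `π` is `π(0)·1 + π(1)·(1 − 1) = 1/6`. -/
theorem mass_into_one : ∑ x, pi3 x * kernel x 1 = 1 / 6 := by
  simp [Fin.sum_univ_three, kernel, acc, rot, pi3]

/-- **The witness is NOT exact**: `π` is not invariant under the kernel (`(πP)(1) = 1/6 ≠ 2/6`),
although the proposal is volume-preserving and `⟨e^{−ΔH}⟩_π = 1` holds exactly (`creutz`). -/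
theorem not_invariant : ¬ ∀ y, ∑ x, pi3 x * kernel x y = pi3 y := by
  intro h
  have h1 : ∑ x, pi3 x * kernel x 1 = pi3 1 := h 1
  rw [mass_into_one] at h1
  norm_num [pi3] at h1

end Witness

/-- **Summary (docket L2-A7).**  There is a finite target `π`, a volume-preserving (bijective),
non-involutive proposal map and the Metropolis rule `min(1, e^{−ΔH})` such that the
`⟨e^{−ΔH}⟩ = 1` identity holds exactly while `π` is not invariant: the identity test
`V1:exact-mismatch:expmdH` can refute volume preservation (X-6) but can never certify exactness
(X-6b). -/
theorem expmdH_identity_does_not_certify_exactness :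
    ∃ (π : Fin 3 → ℝ) (σ : Fin 3 → Fin 3) (P : Fin 3 → Fin 3 → ℝ),
      (∀ x, 0 < π x) ∧ ∑ x, π x = 1 ∧ Function.Bijective σ ∧
      (∑ x, π x * (π (σ x) / π x) = 1) ∧
      (∀ x y, 0 ≤ P x y) ∧ (∀ x, ∑ y, P x y = 1) ∧
      (∀ x y, y ≠ x → P x y = if y = σ x then min 1 (π (σ x) / π x) else 0) ∧
      ¬ ∀ y, ∑ x, π x * P x y = π y :=
  ⟨Witness.pi3, Witness.rot, Witness.kernel, Witness.pi3_pos, Witness.pi3_sum,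
    Witness.rot_bijective, Witness.creutz, Witness.kernel_nonneg, Witness.kernel_row_sum,
    fun _ _ hxy => Witness.kernel_offdiag hxy, Witness.not_invariant⟩

end Summit.Ventures.LatticeQCDFlow.Scoring
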